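import Summits.CriticalPhenomena.SAWScalingLimit.Theorems.SAWRenewalTightnessConfinementPositivityPinnedNumeratorLemmas
import HarnessLib

/-!
# Crux `ConfinementPositivity` (stmt-CriticalPhenomena-17587), line `Sketch` (sign-universality):
# stub Num `stub_pinnedNumerator`, part 2 — the H1 step and the LR step (`PinnedNum.*`)

Second helper file for the registered stub Num `stub_pinnedNumerator` (proved in
`…ConfinementPositivityPinnedNumerator.lean`, which imports this file).  In the list presentation of part 1
(prefix chain `A`, suffix chain `B`, steering piece `π`, weights `x_c^{Σ|·|}`, spans `Σ xEnd`), this file proves the two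
lower-bound steps of Num:

* the **H1 step** (`PinnedNum.tubeFloor_int`, the registered helper stub `pinnedNum_conv_step`,
  `PinnedNum.h1_step`): from the unpinned slab tube `c₁ u_a ≤ mass{chains of span a in the tube r}` for all spans
  `a ≤ n`, the pairs (prefix, suffix) of total span `t ≤ n` both staying in the tube `r` weigh at least `c₁²` times all
  pairs of total span `t` (a convolution over the first span, `PinnedNum.tsum_tsum_conv`), and this inserts into the
  triple sums with the steering piece factored out (`PinnedNum.tsum_tsum_factor`, `PinnedNum.tsum3_comm`);
* the **LR step** (`PinnedNum.lr_step`, `PinnedNum.lr_step3`): for a frozen prefix and suffix, pinning the steering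
  piece of span `s = n - a - b ≥ n/K` at the height `h` that steers the glued chain from `y₀` to `y₁` (`|h| ≤ 2W`), with
  overshoot `≤ s/D`, costs at most the factor `c_L/n` — HeightLocalRichness at `A = 2αK`, valid because
  `s ≥ s₀` (`αK s₀ ≤ W ≤ α n ≤ αK s`) and `|h| ≤ 2W ≤ 2αK s`; the real indicator sums of LR are converted by
  `ExtentOfExpTail.ofReal_tsum_indicator` and `PinnedNum.pieceMass_eq_tsum_list`.

All in `ℝ≥0∞`; no definitions, no named facts.
-/

noncomputable section

open scoped BigOperators ENNReal
open Classical
open Literature.Probability.LatticeModels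
open Literature.Probability.RandomPlanarGeometry Literature.Probability.RandomPlanarGeometry.SAW

namespace Summit.CriticalPhenomena.SAWScalingLimit.Theorems

namespace PinnedNum

/-! ### Generic fibre identities for the factorisation -/

/-- Convolution identity: a double sum restricted to `sp A + sp B = t` is the sum over the first span of the
product of the two fibre masses. -/
theorem tsum_tsum_conv {T' : Type*} (PA PB : T' → Prop) [DecidablePred PA] [DecidablePred PB] (sp : T' → ℤ)
    (w : T' → ℝ≥0∞) (t : ℤ) :
    (∑' A, ∑' B, if (PA A ∧ PB B ∧ sp A + sp B = t) then w A * w B else 0) =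
      ∑' σ : ℤ, (∑' A, if (PA A ∧ sp A = σ) then w A else 0) * ∑' B, if (PB B ∧ sp B = t - σ) then w B else 0 := by
  calc (∑' A, ∑' B, if (PA A ∧ PB B ∧ sp A + sp B = t) then w A * w B else 0)
      = ∑' A, (if PA A then w A else 0) * ∑' B, if (PB B ∧ sp B = t - sp A) then w B else 0 := by
        refine tsum_congr fun A => ?_
        rw [← ENNReal.tsum_mul_left]
        refine tsum_congr fun B => ?_
        by_cases h1 : PA A
        · by_cases h2 : PB B
          · by_cases h3 : sp A + sp B = t
            · have h3' : sp B = t - sp A := by omega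
              simp [h1, h2, h3']
            · have h3' : ¬ sp B = t - sp A := fun h => h3 (by omega)
              simp [h1, h2, h3, h3']
          · simp [h1, h2]
        · simp [h1]
    _ = ∑' σ : ℤ, (∑' A, if sp A = σ then (if PA A then w A else 0) else 0) *
          ∑' B, if (PB B ∧ sp B = t - σ) then w B else 0 :=
        PinnedDen.tsum_fiber (fun A => if PA A then w A else 0) sp
          fun σ => ∑' B, if (PB B ∧ sp B = t - σ) then w B else 0
    _ = _ := tsum_congr fun σ => by
        congr 1
        refine tsum_congr fun A => ?_
        by_cases h1 : PA A <;> by_cases h2 : sp A = σ <;> simp [h1, h2]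

/-- Factorising the steering piece out of the double sum over the prefix and the suffix. -/
theorem tsum_tsum_factor {T' : Type*} (PA PB : T' → Prop) [DecidablePred PA] [DecidablePred PB] (sp : T' → ℤ)
    (w : T' → ℝ≥0∞) (Pπ Bπ : Prop) [Decidable Pπ] [Decidable Bπ] (sπ n : ℤ) (x : ℝ≥0∞) :
    (∑' A, ∑' B, if ((PA A ∧ PB B) ∧ (Pπ ∧ sp A + sπ + sp B = n ∧ Bπ)) then w A * w B * x else 0) =
      (if (Pπ ∧ Bπ) then x else 0) * ∑' A, ∑' B, if (PA A ∧ PB B ∧ sp A + sp B = n - sπ) then w A * w B else 0 := by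
  rw [← ENNReal.tsum_mul_left]
  refine tsum_congr fun A => ?_
  rw [← ENNReal.tsum_mul_left]
  refine tsum_congr fun B => ?_
  by_cases h1 : PA A
  · by_cases h2 : PB B
    · by_cases h3 : Pπ
      · by_cases h4 : Bπ
        · by_cases h5 : sp A + sπ + sp B = n
          · have h5' : sp A + sp B = n - sπ := by omega
            simp [h1, h2, h3, h4, h5, h5', mul_comm]
          · have h5' : ¬ sp A + sp B = n - sπ := fun h => h5 (by omega)
            simp [h1, h2, h3, h4, h5, h5']
        · simp [h4]
      · simp [h3]
    · simp [h2]
  · simp [h1]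

/-- Commuting the steering piece to the outside of the triple sum. -/
theorem tsum3_comm {T' S : Type*} (f : T' → T' → S → ℝ≥0∞) :
    (∑' A, ∑' B, ∑' π, f A B π) = ∑' π, ∑' A, ∑' B, f A B π :=
  calc (∑' A, ∑' B, ∑' π, f A B π) = ∑' A, ∑' π, ∑' B, f A B π := tsum_congr fun _ => ENNReal.tsum_comm
    _ = ∑' π, ∑' A, ∑' B, f A B π := ENNReal.tsum_comm

/-! ### The H1 step: tube floors on the prefix and the suffix -/

/-- The unpinned slab tube at integer spans `a ≤ n` (vacuous for `a < 0`), in the list presentation. -/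
theorem tubeFloor_int (asp r n : ℕ) (c₁ : ℝ) (hn : n ≤ asp * r)
    (hH1 : ∀ L : ℕ, L ≤ asp * r → ENNReal.ofReal c₁ *
        (∑' l : {l : List (List Step) // (∀ w ∈ l, IsIrrBridge w) ∧ (l.map xEnd).sum = (L : ℤ) ∧ True},
          ENNReal.ofReal (criticalFugacity ^ (l.1.map List.length).sum)) ≤
      ∑' l : {l : List (List Step) // (∀ w ∈ l, IsIrrBridge w) ∧ (l.map xEnd).sum = (L : ℤ) ∧
          ∀ i, |traj l.flatten i 1| ≤ (r : ℤ)},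
        ENNReal.ofReal (criticalFugacity ^ (l.1.map List.length).sum))
    (a : ℤ) (ha : a ≤ n) :
    ENNReal.ofReal c₁ * (∑' A : List (List Step), if ((∀ w ∈ A, IsIrrBridge w) ∧ (A.map xEnd).sum = a) then
        ENNReal.ofReal (criticalFugacity ^ (A.map List.length).sum) else 0) ≤
      ∑' A : List (List Step), if (((∀ w ∈ A, IsIrrBridge w) ∧ ∀ i, |traj A.flatten i 1| ≤ (r : ℤ)) ∧
          (A.map xEnd).sum = a) then ENNReal.ofReal (criticalFugacity ^ (A.map List.length).sum) else 0 := by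
  rcases lt_or_ge a 0 with hneg | hnonneg
  · rw [ENNReal.tsum_eq_zero.2 fun A => if_neg fun h => ?_, mul_zero]
    · exact zero_le
    have := span_nonneg A h.1
    omega
  · obtain ⟨L, rfl⟩ : ∃ L : ℕ, a = (L : ℤ) := ⟨a.toNat, (Int.toNat_of_nonneg hnonneg).symm⟩
    have h1 := hH1 L (by omega)
    rw [chainSpanMass_eq_tsum_list, chainSpanMass_eq_tsum_list] at h1
    refine le_trans (le_of_eq (congrArg _ (tsum_congr fun A => ?_))) (h1.trans (le_of_eq (tsum_congr fun A => ?_)))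
    · by_cases hA : (∀ w ∈ A, IsIrrBridge w) <;> by_cases hs : (A.map xEnd).sum = (L : ℤ) <;> simp [hA, hs]
    · by_cases hA : (∀ w ∈ A, IsIrrBridge w) <;> by_cases hs : (A.map xEnd).sum = (L : ℤ) <;>
        by_cases ht : ∀ i, |traj A.flatten i 1| ≤ (r : ℤ) <;> simp [hA, hs, ht]

end PinnedNum

open PinnedNum in
/-- **H1 step (convolution)** (the registered helper stub `pinnedNum_conv_step` of stmt-CriticalPhenomena-17587).
From the tube floors at all spans `≤ n`: the pairs (prefix, suffix) of total span `t ≤ n` both staying in the tube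
`r` weigh at least `c₁²` times all pairs of total span `t`. -/
theorem pinnedNum_conv_step : ∀ (n r : ℕ) (c₁ : ℝ),
    (∀ a : ℤ, a ≤ n → ENNReal.ofReal c₁ *
      (∑' A : List (List Step), if ((∀ w ∈ A, IsIrrBridge w) ∧ (A.map xEnd).sum = a) then
        ENNReal.ofReal (criticalFugacity ^ (A.map List.length).sum) else 0) ≤
      ∑' A : List (List Step), if (((∀ w ∈ A, IsIrrBridge w) ∧ ∀ i, |traj A.flatten i 1| ≤ (r : ℤ)) ∧
          (A.map xEnd).sum = a) then ENNReal.ofReal (criticalFugacity ^ (A.map List.length).sum) else 0) →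
    ∀ t : ℤ, t ≤ n →
    ENNReal.ofReal c₁ ^ 2 * (∑' A : List (List Step), ∑' B : List (List Step),
        if ((∀ w ∈ A, IsIrrBridge w) ∧ (∀ w ∈ B, IsIrrBridge w) ∧ (A.map xEnd).sum + (B.map xEnd).sum = t) then
          ENNReal.ofReal (criticalFugacity ^ (A.map List.length).sum) *
            ENNReal.ofReal (criticalFugacity ^ (B.map List.length).sum) else 0) ≤
      ∑' A : List (List Step), ∑' B : List (List Step),
        if (((∀ w ∈ A, IsIrrBridge w) ∧ ∀ i, |traj A.flatten i 1| ≤ (r : ℤ)) ∧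
            ((∀ w ∈ B, IsIrrBridge w) ∧ ∀ i, |traj B.flatten i 1| ≤ (r : ℤ)) ∧
            (A.map xEnd).sum + (B.map xEnd).sum = t) then
          ENNReal.ofReal (criticalFugacity ^ (A.map List.length).sum) *
            ENNReal.ofReal (criticalFugacity ^ (B.map List.length).sum) else 0 := by
  intro n r c₁ hT t ht
  rw [tsum_tsum_conv (fun A : List (List Step) => ∀ w ∈ A, IsIrrBridge w) (fun B => ∀ w ∈ B, IsIrrBridge w)
      (fun A => (A.map xEnd).sum) (fun A => ENNReal.ofReal (criticalFugacity ^ (A.map List.length).sum)) t,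
    tsum_tsum_conv (fun A : List (List Step) => (∀ w ∈ A, IsIrrBridge w) ∧ ∀ i, |traj A.flatten i 1| ≤ (r : ℤ))
      (fun B => (∀ w ∈ B, IsIrrBridge w) ∧ ∀ i, |traj B.flatten i 1| ≤ (r : ℤ))
      (fun A => (A.map xEnd).sum) (fun A => ENNReal.ofReal (criticalFugacity ^ (A.map List.length).sum)) t,
    ← ENNReal.tsum_mul_left]
  refine ENNReal.tsum_le_tsum fun σ => ?_
  have hzero : ∀ b : ℤ, b < 0 → (∑' A : List (List Step), if ((∀ w ∈ A, IsIrrBridge w) ∧ (A.map xEnd).sum = b)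
      then ENNReal.ofReal (criticalFugacity ^ (A.map List.length).sum) else 0) = 0 := fun b hb =>
    ENNReal.tsum_eq_zero.2 fun A => if_neg fun h => by
      have := span_nonneg A h.1
      omega
  rcases lt_or_ge σ 0 with h1 | h1
  · simp only [hzero σ h1, zero_mul, mul_zero]
    exact zero_le
  rcases lt_or_ge (t - σ) 0 with h2 | h2
  · simp only [hzero (t - σ) h2, mul_zero]
    exact zero_le
  calc ENNReal.ofReal c₁ ^ 2 * ((∑' A : List (List Step), if ((∀ w ∈ A, IsIrrBridge w) ∧ (A.map xEnd).sum = σ)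
        then ENNReal.ofReal (criticalFugacity ^ (A.map List.length).sum) else 0) *
        ∑' B : List (List Step), if ((∀ w ∈ B, IsIrrBridge w) ∧ (B.map xEnd).sum = t - σ)
          then ENNReal.ofReal (criticalFugacity ^ (B.map List.length).sum) else 0)
      = (ENNReal.ofReal c₁ * ∑' A : List (List Step), if ((∀ w ∈ A, IsIrrBridge w) ∧ (A.map xEnd).sum = σ)
          then ENNReal.ofReal (criticalFugacity ^ (A.map List.length).sum) else 0) *
        (ENNReal.ofReal c₁ * ∑' B : List (List Step), if ((∀ w ∈ B, IsIrrBridge w) ∧ (B.map xEnd).sum = t - σ)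
          then ENNReal.ofReal (criticalFugacity ^ (B.map List.length).sum) else 0) := by ring
    _ ≤ _ := mul_le_mul' (hT σ (by omega)) (hT (t - σ) (by omega))

namespace PinnedNum

/-- **H1 step (triple sum).**  Inserting the tube floors on the prefix and the suffix of the triples. -/
theorem h1_step (n : ℕ) (K r : ℕ) (c₁ : ℝ)
    (hT : ∀ a : ℤ, a ≤ n → ENNReal.ofReal c₁ *
      (∑' A : List (List Step), if ((∀ w ∈ A, IsIrrBridge w) ∧ (A.map xEnd).sum = a) then
        ENNReal.ofReal (criticalFugacity ^ (A.map List.length).sum) else 0) ≤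
      ∑' A : List (List Step), if (((∀ w ∈ A, IsIrrBridge w) ∧ ∀ i, |traj A.flatten i 1| ≤ (r : ℤ)) ∧
          (A.map xEnd).sum = a) then ENNReal.ofReal (criticalFugacity ^ (A.map List.length).sum) else 0) :
    ENNReal.ofReal c₁ ^ 2 * (∑' A : List (List Step), ∑' B : List (List Step), ∑' π : List Step,
        if (((∀ w ∈ A, IsIrrBridge w) ∧ ∀ w ∈ B, IsIrrBridge w) ∧ (IsIrrBridge π ∧
            (A.map xEnd).sum + xEnd π + (B.map xEnd).sum = n ∧ (n : ℤ) ≤ (K : ℤ) * xEnd π)) then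
          ENNReal.ofReal (criticalFugacity ^ (A.map List.length).sum) *
            ENNReal.ofReal (criticalFugacity ^ (B.map List.length).sum) *
              ENNReal.ofReal (criticalFugacity ^ π.length) else 0) ≤
      ∑' A : List (List Step), ∑' B : List (List Step), ∑' π : List Step,
        if ((((∀ w ∈ A, IsIrrBridge w) ∧ ∀ i, |traj A.flatten i 1| ≤ (r : ℤ)) ∧
            ((∀ w ∈ B, IsIrrBridge w) ∧ ∀ i, |traj B.flatten i 1| ≤ (r : ℤ))) ∧ (IsIrrBridge π ∧
            (A.map xEnd).sum + xEnd π + (B.map xEnd).sum = n ∧ (n : ℤ) ≤ (K : ℤ) * xEnd π)) then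
          ENNReal.ofReal (criticalFugacity ^ (A.map List.length).sum) *
            ENNReal.ofReal (criticalFugacity ^ (B.map List.length).sum) *
              ENNReal.ofReal (criticalFugacity ^ π.length) else 0 := by
  conv_lhs => rw [tsum3_comm, ← ENNReal.tsum_mul_left]
  conv_rhs => rw [tsum3_comm]
  refine ENNReal.tsum_le_tsum fun π => ?_
  rw [tsum_tsum_factor (fun A : List (List Step) => ∀ w ∈ A, IsIrrBridge w) (fun B => ∀ w ∈ B, IsIrrBridge w)
      (fun A => (A.map xEnd).sum) (fun A => ENNReal.ofReal (criticalFugacity ^ (A.map List.length).sum))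
      (IsIrrBridge π) ((n : ℤ) ≤ (K : ℤ) * xEnd π) (xEnd π) n (ENNReal.ofReal (criticalFugacity ^ π.length)),
    tsum_tsum_factor (fun A : List (List Step) => (∀ w ∈ A, IsIrrBridge w) ∧ ∀ i, |traj A.flatten i 1| ≤ (r : ℤ))
      (fun B => (∀ w ∈ B, IsIrrBridge w) ∧ ∀ i, |traj B.flatten i 1| ≤ (r : ℤ))
      (fun A => (A.map xEnd).sum) (fun A => ENNReal.ofReal (criticalFugacity ^ (A.map List.length).sum))
      (IsIrrBridge π) ((n : ℤ) ≤ (K : ℤ) * xEnd π) (xEnd π) n (ENNReal.ofReal (criticalFugacity ^ π.length))]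
  by_cases hπ : IsIrrBridge π ∧ (n : ℤ) ≤ (K : ℤ) * xEnd π
  · rw [if_pos hπ, mul_left_comm]
    refine mul_le_mul' le_rfl (pinnedNum_conv_step n r c₁ hT _ ?_)
    have := StripMass.one_le_xEnd_of_ne_nil hπ.1.bridge hπ.1.ne_nil
    omega
  · simp [hπ]

/-! ### The LR step: steering pieces -/

/-- Factorising a constant condition and weight out of a `tsum` of indicators. -/
theorem tsum_factor_const {S : Type*} (P : Prop) [Decidable P] (Q : S → Prop) [DecidablePred Q] (x : ℝ≥0∞)
    (ν : S → ℝ≥0∞) : (∑' π, if (P ∧ Q π) then x * ν π else 0) = (if P then x else 0) * ∑' π, if Q π then ν π else 0 := by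
  rw [← ENNReal.tsum_mul_left]
  refine tsum_congr fun π => ?_
  by_cases h1 : P <;> by_cases h2 : Q π <;> simp [h1, h2]

/-- **LR step (one prefix, one suffix).**  For frozen prefix span `a ≥ 0` and suffix span `b ≥ 0` and a target
height `|h| ≤ 2W`, the steering pieces of span `n - a - b ≥ n/K` with height `h` and overshoot `≤ span/D` weigh at
least `c/n` times all pieces of that span (LR at `A = 2αK`, spans `≥ s₀` because `αK s₀ ≤ W ≤ α n`). -/
theorem lr_step (K α s₀ D n W : ℕ) (c : ℝ) (hc : 0 ≤ c) (hK : 1 ≤ K) (hα : 1 ≤ α)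
    (hLR : ∀ s : ℕ, s₀ ≤ s → ∀ h : ℤ, |h| ≤ ((2 * α * K * s : ℕ) : ℤ) →
      c / s * (∑' w : {w : List Step // IsIrrBridge w},
          {w : {w : List Step // IsIrrBridge w} | xEnd w.1 = s}.indicator
            (fun w => criticalFugacity ^ w.1.length) w) ≤
        ∑' w : {w : List Step // IsIrrBridge w},
          {w : {w : List Step // IsIrrBridge w} | xEnd w.1 = s ∧ wEnd w.1 1 = h ∧
              ∀ i, (D : ℤ) * min h 0 - (s : ℤ) ≤ (D : ℤ) * traj w.1 i 1 ∧
                (D : ℤ) * traj w.1 i 1 ≤ (D : ℤ) * max h 0 + (s : ℤ)}.indicator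
            (fun w => criticalFugacity ^ w.1.length) w)
    (hs₀ : α * K * s₀ ≤ W) (hWn : W ≤ α * n) (a b : ℤ) (ha : 0 ≤ a) (hb : 0 ≤ b) (h : ℤ)
    (hh : |h| ≤ 2 * (W : ℤ)) :
    ENNReal.ofReal (c / n) * (∑' π : List Step,
        if (IsIrrBridge π ∧ a + xEnd π + b = (n : ℤ) ∧ (n : ℤ) ≤ (K : ℤ) * xEnd π) then
          ENNReal.ofReal (criticalFugacity ^ π.length) else 0) ≤
      ∑' π : List Step, if (IsIrrBridge π ∧ a + xEnd π + b = (n : ℤ) ∧ (n : ℤ) ≤ (K : ℤ) * xEnd π ∧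
          wEnd π 1 = h ∧ ∀ i, (D : ℤ) * min h 0 - xEnd π ≤ (D : ℤ) * traj π i 1 ∧
            (D : ℤ) * traj π i 1 ≤ (D : ℤ) * max h 0 + xEnd π) then
        ENNReal.ofReal (criticalFugacity ^ π.length) else 0 := by
  -- the steering span is `t = n - a - b`; if no piece qualifies the left side vanishes
  by_cases ht : 1 ≤ (n : ℤ) - a - b ∧ (n : ℤ) ≤ (K : ℤ) * ((n : ℤ) - a - b)
  swap
  · rw [ENNReal.tsum_eq_zero.2 fun π => ?_, mul_zero]
    · exact zero_le
    refine if_neg fun hcond => ht ?_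
    have h1 : 1 ≤ xEnd π := StripMass.one_le_xEnd_of_ne_nil hcond.1.bridge hcond.1.ne_nil
    have h2 : xEnd π = (n : ℤ) - a - b := by linarith [hcond.2.1]
    exact ⟨by omega, by rw [← h2]; exact hcond.2.2⟩
  obtain ⟨ht1, htK⟩ := ht
  obtain ⟨s, hs⟩ : ∃ s : ℕ, (s : ℤ) = (n : ℤ) - a - b := ⟨((n : ℤ) - a - b).toNat, Int.toNat_of_nonneg (by omega)⟩
  rw [← hs] at ht1 htK
  have hs1 : 1 ≤ s := by exact_mod_cast ht1
  have hsn : s ≤ n := by omega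
  have hnK : n ≤ K * s := by exact_mod_cast htK
  have hWs : W ≤ α * (K * s) := hWn.trans (Nat.mul_le_mul_left α hnK)
  have hs₀s : s₀ ≤ s := by
    have h1 : α * K * s₀ ≤ α * K * s := by rw [mul_assoc α K s]; exact hs₀.trans hWs
    exact Nat.le_of_mul_le_mul_left h1 (by positivity)
  have hhs : |h| ≤ ((2 * α * K * s : ℕ) : ℤ) := by
    have h2 : (W : ℤ) ≤ ((α * (K * s) : ℕ) : ℤ) := by exact_mod_cast hWs
    push_cast at h2 ⊢
    linarith
  -- LR in `ℝ≥0∞`, over all words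
  have hmain := ENNReal.ofReal_le_ofReal (hLR s hs₀s h hhs)
  rw [ENNReal.ofReal_mul (by positivity), ExtentOfExpTail.ofReal_tsum_indicator,
    ExtentOfExpTail.ofReal_tsum_indicator, pieceMass_eq_tsum_list (fun w => xEnd w = (s : ℤ)),
    pieceMass_eq_tsum_list (fun w => xEnd w = (s : ℤ) ∧ wEnd w 1 = h ∧
      ∀ i, (D : ℤ) * min h 0 - (s : ℤ) ≤ (D : ℤ) * traj w i 1 ∧ (D : ℤ) * traj w i 1 ≤ (D : ℤ) * max h 0 + (s : ℤ))]
    at hmain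
  -- identify the two sides on the fibre `xEnd π = s`
  have e1 : (∑' π : List Step, if (IsIrrBridge π ∧ a + xEnd π + b = (n : ℤ) ∧ (n : ℤ) ≤ (K : ℤ) * xEnd π) then
      ENNReal.ofReal (criticalFugacity ^ π.length) else 0) =
      ∑' π : List Step, if (IsIrrBridge π ∧ xEnd π = (s : ℤ)) then ENNReal.ofReal (criticalFugacity ^ π.length)
        else 0 := by
    refine tsum_congr fun π => if_congr ⟨fun hq => ⟨hq.1, by omega⟩, fun hq => ⟨hq.1, by omega, ?_⟩⟩ rfl rfl
    rw [hq.2]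
    exact htK
  have e2 : (∑' π : List Step, if (IsIrrBridge π ∧ xEnd π = (s : ℤ) ∧ wEnd π 1 = h ∧
      ∀ i, (D : ℤ) * min h 0 - (s : ℤ) ≤ (D : ℤ) * traj π i 1 ∧ (D : ℤ) * traj π i 1 ≤ (D : ℤ) * max h 0 + (s : ℤ))
        then ENNReal.ofReal (criticalFugacity ^ π.length) else 0) =
      ∑' π : List Step, if (IsIrrBridge π ∧ a + xEnd π + b = (n : ℤ) ∧ (n : ℤ) ≤ (K : ℤ) * xEnd π ∧
          wEnd π 1 = h ∧ ∀ i, (D : ℤ) * min h 0 - xEnd π ≤ (D : ℤ) * traj π i 1 ∧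
            (D : ℤ) * traj π i 1 ≤ (D : ℤ) * max h 0 + xEnd π) then
        ENNReal.ofReal (criticalFugacity ^ π.length) else 0 := by
    refine tsum_congr fun π => ?_
    by_cases hπ : xEnd π = (s : ℤ)
    · refine if_congr ⟨fun hq => ⟨hq.1, by omega, by rw [hπ]; exact htK, hq.2.2.1, ?_⟩,
        fun hq => ⟨hq.1, hπ, hq.2.2.2.1, ?_⟩⟩ rfl rfl
      · rw [hπ]; exact hq.2.2.2
      · have := hq.2.2.2.2; rwa [hπ] at this
    · rw [if_neg fun hq => hπ hq.2.1, if_neg fun hq => hπ (by have := hq.2.1; omega)]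
  rw [e1, ← e2]
  refine le_trans ?_ hmain
  refine mul_le_mul' (ENNReal.ofReal_le_ofReal ?_) le_rfl
  exact div_le_div_of_nonneg_left hc (by exact_mod_cast hs1) (by exact_mod_cast hsn)

/-- **LR step (triple sum).**  Pinning the steering piece of every triple at the height that steers the glued
chain from `y₀` to `y₁`, with overshoot `≤ span/D`, costs at most the factor `c/n`. -/
theorem lr_step3 (K α s₀ D n W r : ℕ) (c : ℝ) (hc : 0 ≤ c) (hK : 1 ≤ K) (hα : 1 ≤ α)
    (hLR : ∀ s : ℕ, s₀ ≤ s → ∀ h : ℤ, |h| ≤ ((2 * α * K * s : ℕ) : ℤ) →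
      c / s * (∑' w : {w : List Step // IsIrrBridge w},
          {w : {w : List Step // IsIrrBridge w} | xEnd w.1 = s}.indicator
            (fun w => criticalFugacity ^ w.1.length) w) ≤
        ∑' w : {w : List Step // IsIrrBridge w},
          {w : {w : List Step // IsIrrBridge w} | xEnd w.1 = s ∧ wEnd w.1 1 = h ∧
              ∀ i, (D : ℤ) * min h 0 - (s : ℤ) ≤ (D : ℤ) * traj w.1 i 1 ∧
                (D : ℤ) * traj w.1 i 1 ≤ (D : ℤ) * max h 0 + (s : ℤ)}.indicator
            (fun w => criticalFugacity ^ w.1.length) w)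
    (hs₀ : α * K * s₀ ≤ W) (hWn : W ≤ α * n) (y₀ y₁ : ℤ) (hy₀ : 2 * |y₀| ≤ (W : ℤ)) (hy₁ : 2 * |y₁| ≤ (W : ℤ))
    (hr : 8 * r ≤ W) :
    ENNReal.ofReal (c / n) * (∑' A : List (List Step), ∑' B : List (List Step), ∑' π : List Step,
        if ((((∀ w ∈ A, IsIrrBridge w) ∧ ∀ i, |traj A.flatten i 1| ≤ (r : ℤ)) ∧
            ((∀ w ∈ B, IsIrrBridge w) ∧ ∀ i, |traj B.flatten i 1| ≤ (r : ℤ))) ∧ (IsIrrBridge π ∧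
            (A.map xEnd).sum + xEnd π + (B.map xEnd).sum = n ∧ (n : ℤ) ≤ (K : ℤ) * xEnd π)) then
          ENNReal.ofReal (criticalFugacity ^ (A.map List.length).sum) *
            ENNReal.ofReal (criticalFugacity ^ (B.map List.length).sum) *
              ENNReal.ofReal (criticalFugacity ^ π.length) else 0) ≤
      ∑' A : List (List Step), ∑' B : List (List Step), ∑' π : List Step,
        if ((((∀ w ∈ A, IsIrrBridge w) ∧ ∀ i, |traj A.flatten i 1| ≤ (r : ℤ)) ∧
            ((∀ w ∈ B, IsIrrBridge w) ∧ ∀ i, |traj B.flatten i 1| ≤ (r : ℤ))) ∧ (IsIrrBridge π ∧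
            (A.map xEnd).sum + xEnd π + (B.map xEnd).sum = n ∧ (n : ℤ) ≤ (K : ℤ) * xEnd π ∧
            wEnd π 1 = y₁ - y₀ - wEnd A.flatten 1 - wEnd B.flatten 1 ∧
            ∀ i, (D : ℤ) * min (y₁ - y₀ - wEnd A.flatten 1 - wEnd B.flatten 1) 0 - xEnd π ≤ (D : ℤ) * traj π i 1 ∧
              (D : ℤ) * traj π i 1 ≤ (D : ℤ) * max (y₁ - y₀ - wEnd A.flatten 1 - wEnd B.flatten 1) 0 + xEnd π)) then
          ENNReal.ofReal (criticalFugacity ^ (A.map List.length).sum) *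
            ENNReal.ofReal (criticalFugacity ^ (B.map List.length).sum) *
              ENNReal.ofReal (criticalFugacity ^ π.length) else 0 := by
  rw [← ENNReal.tsum_mul_left]
  refine ENNReal.tsum_le_tsum fun A => ?_
  rw [← ENNReal.tsum_mul_left]
  refine ENNReal.tsum_le_tsum fun B => ?_
  rw [tsum_factor_const, tsum_factor_const]
  by_cases hP : ((∀ w ∈ A, IsIrrBridge w) ∧ ∀ i, |traj A.flatten i 1| ≤ (r : ℤ)) ∧
      ((∀ w ∈ B, IsIrrBridge w) ∧ ∀ i, |traj B.flatten i 1| ≤ (r : ℤ))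
  · rw [if_pos hP, mul_left_comm]
    refine mul_le_mul' le_rfl (lr_step K α s₀ D n W c hc hK hα hLR hs₀ hWn _ _ (span_nonneg A hP.1.1)
      (span_nonneg B hP.2.1) _ ?_)
    have hYA : |wEnd A.flatten 1| ≤ (r : ℤ) := by rw [← traj_length]; exact hP.1.2 _
    have hYB : |wEnd B.flatten 1| ≤ (r : ℤ) := by rw [← traj_length]; exact hP.2.2 _
    have ha0 := le_abs_self y₀
    have ha0' := neg_abs_le y₀
    have ha1 := le_abs_self y₁
    have ha1' := neg_abs_le y₁
    have hr' : 8 * (r : ℤ) ≤ (W : ℤ) := by exact_mod_cast hr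
    obtain ⟨hYA1, hYA2⟩ := abs_le.1 hYA
    obtain ⟨hYB1, hYB2⟩ := abs_le.1 hYB
    rw [abs_le]
    constructor <;> omega
  · simp [hP]

end PinnedNum

end Summit.CriticalPhenomena.SAWScalingLimit.Theorems
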